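import Summits.CriticalPhenomena.SAWScalingLimit.Theorems.SAWTotalPositivityCriticalBubbleBoundJoinMacroInjection
import Summits.CriticalPhenomena.SAWScalingLimit.Theorems.SAWTotalPositivityCriticalBubbleBoundJoinMacroFloor

/-!
# The LOWER side of the macroscopic rarity knob: `Umac_i ≳ 2^{(κ-1) i} (R'_i)²`
(crux `SAWTotalPositivity.CriticalBubbleBound`, stmt-CriticalPhenomena-7117; line `docking-census-joining`,
registered stubs `Umac_ge_of_joinEntropyAt`, `Umac_ge`, lead prover c8)

The ledger `θ - 1 = κ + π` of the join-mass programme feeds the crux from a join ENTROPY exponent `κ`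
(`JoinEntropyAt κ`: `c 2^{(κ-1) i} (R'_i)² ≤ Dent i` for large `i`, with `R'_i = blockMass jterm i`) and a
macroscopic RARITY exponent `π` (`JoinMacroRarity π`, an UPPER bound on `Umac i`, open for `π > 0`).
This file records the certified LOWER side of the rarity knob: the macroscopic injection
`Dent_le_Umac : Dent i ≤ 64 x_c^{-16} Umac i` (`i ≥ 6`; every Madras join, re-rooted, has its junction
corner as a MACROSCOPIC global join plaquette of the target class) transports the entropy to `Umac`:

* `Umac_ge_of_joinEntropyAt` — `JoinEntropyAt κ → ∃ c > 0, ∃ i₀, ∀ i ≥ i₀, c 2^{(κ-1) i} (R'_i)² ≤ Umac i`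
  with `c' = c / (64 x_c^{-16})`;
* `Umac_ge` — the proved instance `κ = 3/2` (`joinEntropyAt_three_halves`, Hammond's Lemma 4.12):
  `c 2^{i/2} (R'_i)² ≤ Umac i` for large `i`.

Meaning: on `x_c`-average a class of dyadic scale `2^{i+1}` carries `≳ 2^{i/2} (R'_i)² / R'_{i+1}`
macroscopic global join plaquettes, so the knob's exponent `π` can never exceed `θ_block - 3/2`.

Source: A. Hammond, *An upper bound on the number of self-avoiding polygons via joining*, Ann. Probab. 46
(2018) 175–206, Prop. 4.5 and Lemma 4.12.
-/

noncomputable section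

open Literature.Probability.LatticeModels
open Literature.Probability.RandomPlanarGeometry Literature.Probability.RandomPlanarGeometry.SAW
open scoped BigOperators
open Summit.CriticalPhenomena.SAWScalingLimit.Theorems.CriticalBubbleBound.Negative (e₀)
open Summit.CriticalPhenomena.SAWScalingLimit.Theorems.CriticalBubbleBound.Docking

namespace Summit.CriticalPhenomena.SAWScalingLimit.Theorems.CriticalBubbleBound.Join

/-- **Entropy transports to the macroscopic rarity mass.** If the shifted class blocks have join entropy
with exponent `κ` (`c 2^{(κ-1) i} (R'_i)² ≤ Dent i` for large `i`), then, since every arrow of `Dent i`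
lands on a macroscopic global join plaquette of the target block (`Dent_le_Umac`:
`Dent i ≤ 64 x_c^{-16} Umac i` for `i ≥ 6`), the macroscopic rarity mass obeys the same lower bound with
the constant `c / (64 x_c^{-16}) > 0`, for `i ≥ max i₀ 6`. [cite: Hammond2015SAPJoining, Lemma 4.12] -/
theorem Umac_ge_of_joinEntropyAt : ∀ κ : ℝ, JoinEntropyAt κ → ∃ c : ℝ, 0 < c ∧ ∃ i₀ : ℕ, ∀ i : ℕ, i₀ ≤ i → c * (2 : ℝ) ^ ((κ - 1) * (i : ℝ)) * blockMass jterm i ^ 2 ≤ Umac i := by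
  intro κ hκ
  obtain ⟨c, hc, i₀, hent⟩ := hκ
  have hx0 : 0 < criticalFugacity := criticalFugacity_pos_lt_one'.1
  set K : ℝ := 64 * criticalFugacity⁻¹ ^ 16 with hK
  have hK0 : 0 < K := mul_pos (by norm_num) (pow_pos (inv_pos.2 hx0) 16)
  refine ⟨c / K, div_pos hc hK0, max i₀ 6, fun i hi => ?_⟩
  have hi₀ : i₀ ≤ i := le_trans (le_max_left _ _) hi
  have hi6 : 6 ≤ i := le_trans (le_max_right _ _) hi
  have h1 : c * (2 : ℝ) ^ ((κ - 1) * (i : ℝ)) * blockMass jterm i ^ 2 ≤ Dent i := hent i hi₀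
  have h2 : Dent i ≤ K * Umac i := Dent_le_Umac i hi6
  have h3 : c * (2 : ℝ) ^ ((κ - 1) * (i : ℝ)) * blockMass jterm i ^ 2 ≤ K * Umac i := h1.trans h2
  have hrew : c / K * (2 : ℝ) ^ ((κ - 1) * (i : ℝ)) * blockMass jterm i ^ 2
      = (c * (2 : ℝ) ^ ((κ - 1) * (i : ℝ)) * blockMass jterm i ^ 2) / K := by
    ring
  rw [hrew, div_le_iff₀ hK0, mul_comm (Umac i) K]
  exact h3

/-- **The certified lower side of the macroscopic rarity knob** (`κ = 3/2`, Hammond's entropy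
`joinEntropyAt_three_halves` through the macroscopic injection `Dent_le_Umac`): for all large `i`,
`c 2^{i/2} (R'_i)² ≤ Umac i` — on `x_c`-average a class of scale `2^{i+1}` carries
`≳ 2^{i/2} (R'_i)² / R'_{i+1}` macroscopic global join plaquettes. [cite: Hammond2015SAPJoining, Lemma 4.12] -/
theorem Umac_ge : ∃ c : ℝ, 0 < c ∧ ∃ i₀ : ℕ, ∀ i : ℕ, i₀ ≤ i → c * (2 : ℝ) ^ ((1 / 2 : ℝ) * (i : ℝ)) * blockMass jterm i ^ 2 ≤ Umac i := by
  obtain ⟨c, hc, i₀, h⟩ := Umac_ge_of_joinEntropyAt (3 / 2) joinEntropyAt_three_halves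
  refine ⟨c, hc, i₀, fun i hi => ?_⟩
  have h12 : ((3 / 2 : ℝ) - 1) = 1 / 2 := by norm_num
  have := h i hi
  rw [h12] at this
  exact this

end Summit.CriticalPhenomena.SAWScalingLimit.Theorems.CriticalBubbleBound.Join

end
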